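import Literature.Computability.Cryptography.Pseudorandomness
import Literature.Computability.Cryptography.YaoNextBitProbability
import HarnessLib

/-!
# Yao's theorem: pseudorandomness iff next-bit unpredictability (proof)

Sibling proof file of `Pseudorandomness.lean` for **crypto-foundations.S21** (D-0014; named apart
from `PseudorandomnessProofs.lean`, which carries the S09 glue and its proof devices, in the manner
of `CryptoFoundationsOneWayFunctionsS24Proofs.lean`): it discharges

* `Literature.Computability.Cryptography.isPseudorandom_iff_isNextBitUnpredictable_holds :
  isPseudorandom_iff_isNextBitUnpredictable`

— an ensemble `X` on `ℓ n`-bit strings (`ℓ` polynomially bounded and polynomial-time computable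
in unary) is pseudorandom iff it passes all probabilistic polynomial-time next-bit tests
(Yao 1982; Goldreich 2001, Thm. 3.3.7; Arora–Barak 2009, Thm. 9.11, whose random-position form
of unpredictability is the one vendored as `IsNextBitUnpredictable`).

## The printed proof and its rendering

Both directions follow Goldreich's proof of Thm. 3.3.7 (2004 printing, pp. 119–123), by
contradiction along the infinitely many levels `n` at which the assumed adversary has a
noticeable advantage:

* **only if** (p. 120): a next-bit predictor `A` with noticeable advantage yields the
  distinguisher `D_A` "invoke `A`, output 1 iff the prediction is correct"; on `X_n` it accepts
  with `A`'s success probability, on the uniform ensemble with probability exactly `1/2`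
  (`YaoNB.acceptPMF_distAlg_eq`, `YaoNB.acceptPMF_distAlg_uniformBits`). With the random-position
  predictor of Arora–Barak the distinguisher tests the single most biased position `i₀`
  (`YaoNB.exists_abs_nextBitAdvantage_le`: some position is at least as biased as the average).
* **if** (pp. 121–123, Claims 3.3.7.1–3.3.7.2): a distinguisher `D` with noticeable gap yields
  the predictor `A_D` "pad the prefix with uniform bits, run `D`, answer the first padding bit
  or its complement", whose advantage is the telescoping average of the hybrid gaps,
  `(Pr[D(X_n)=1] − Pr[D(U_{ℓ n})=1]) / ℓ(n)` (`YaoNB.nextBitAdvantage_predAlg`). Negligibility in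
  the tree (`SuperpolynomialDecay`) is two-sided, so Goldreich's "dropping of the absolute
  value / flipping the output" step is not needed: a hugely negative advantage is as
  non-negligible as a positive one.

Two points are specific to the tree's model of randomized algorithms (`RandAlg`: the number of
coins is a function `coinLen` of the *input length* only, not computed by the machine). A
reduction calling `A` (resp. `D`) must be handed the callee's coin count, and `D_A` also the
position `i₀`; both are transmitted through the reduction's own coin budget
(`YaoNextBitPrograms.lean`). This is only possible if distinct relevant (level, prefix length)
pairs have distinct input lengths `2n + 2 + i`; hence the contradiction is run along a *sparse*
subsequence of the bad levels, `t_{j+1} > t_j + ℓ(t_j)` (`YaoNB.exists_sparse_seq`,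
`YaoNB.levels_injective`) — an infinite subset of the infinitely many bad `n`'s of the printed
proof, which is all the argument uses. The machines are polynomial time by
`YaoNB.isPPT_distAlg` / `YaoNB.isPPT_predAlg`; the latter is where `ℓ` must be computable in
unary (to produce the `ℓ(n) − i` padding bits from `1ⁿ`), the polynomial bound on `ℓ` bounds the
coin budgets and converts the `1/ℓ(n)` loss into a polynomial factor
(`SuperpolynomialDecay.polynomial_mul`).

## References

* A. C. Yao, *Theory and applications of trapdoor functions*, 23rd FOCS, IEEE 1982, 80–91.
* O. Goldreich, *Foundations of Cryptography I: Basic Tools*, CUP 2001 (2004 printing,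
  ISBN 0-521-79172-3), §3.3.5, Def. 3.3.6, Thm. 3.3.7 with its proof (pp. 119–123).
* S. Arora, B. Barak, *Computational Complexity: A Modern Approach*, CUP 2009, Def. 9.8,
  Thm. 9.11.
-/

namespace Literature.Computability.Cryptography

open Filter Asymptotics _root_.Computability Complexity Finset Topology

namespace YaoNB

/-! ### Negligible versus frequently noticeable -/

/-- A function that is **not** negligible is noticeable along infinitely many `n`:
`δ ≤ n^k |f n|` frequently, for some `k` and `δ > 0`. [Goldreich 2001, §1.3.3 and the opening of
the proof of Thm. 3.3.7 ("for some polynomial `p` and infinitely many `n`'s")] [folklore] -/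
theorem exists_frequently_of_not_superpolynomialDecay {f : ℕ → ℝ}
    (h : ¬ SuperpolynomialDecay atTop (fun n : ℕ => (n : ℝ)) f) :
    ∃ (k : ℕ) (δ : ℝ), 0 < δ ∧ ∃ᶠ n : ℕ in atTop, δ ≤ (n : ℝ) ^ k * |f n| := by
  by_contra hall
  apply h
  intro k
  rw [NormedAddGroup.tendsto_nhds_zero]
  intro ε hε
  by_contra hev
  refine hall ⟨k, ε, hε, (Filter.not_eventually.1 hev).mono fun n hn => ?_⟩
  rwa [not_lt, Real.norm_eq_abs, abs_mul, abs_of_nonneg (by positivity)] at hn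

/-- Conversely, a function noticeable along infinitely many `n` is not negligible. [folklore] -/
theorem not_superpolynomialDecay_of_frequently {f : ℕ → ℝ} {k : ℕ} {δ : ℝ} (hδ : 0 < δ)
    (h : ∃ᶠ n : ℕ in atTop, δ ≤ (n : ℝ) ^ k * |f n|) :
    ¬ SuperpolynomialDecay atTop (fun n : ℕ => (n : ℝ)) f := by
  intro hs
  have ht := hs k
  rw [NormedAddGroup.tendsto_nhds_zero] at ht
  obtain ⟨n, h1, h2⟩ := (h.and_eventually (ht δ hδ)).exists
  rw [Real.norm_eq_abs, abs_mul, abs_of_nonneg (by positivity)] at h2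
  linarith

/-! ### Sparse subsequences of an infinite set of levels -/

/-- From infinitely many good levels one can extract a sequence of good levels with prescribed
gaps: `t (j+1) > t j + g (t j)`. [folklore] -/
theorem exists_sparse_seq {P : ℕ → Prop} (h : ∃ᶠ n in atTop, P n) (g : ℕ → ℕ) :
    ∃ t : ℕ → ℕ, (∀ j, P (t j)) ∧ ∀ j, t j + g (t j) < t (j + 1) := by
  have hex : ∀ a, ∃ b, a ≤ b ∧ P b := fun a => Filter.frequently_atTop.1 h a
  choose nx hge hP using hex
  let t : ℕ → ℕ := fun j => Nat.rec (nx 0) (fun _ tj => nx (tj + g tj + 1)) j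
  refine ⟨t, fun j => ?_, fun j => ?_⟩
  · cases j with
    | zero => exact hP 0
    | succ j => exact hP _
  · show t j + g (t j) < nx (t j + g (t j) + 1)
    have := hge (t j + g (t j) + 1)
    omega

/-- A gapped sequence is strictly increasing. [folklore] -/
theorem strictMono_of_gap {t g : ℕ → ℕ} (hgap : ∀ j, t j + g (t j) < t (j + 1)) : StrictMono t :=
  strictMono_nat_of_lt_succ fun j => by have := hgap j; omega

/-- **Distinct (level, prefix length) pairs have distinct input lengths** along a gapped
sequence: `2 t j + 2 + i = 2 t j' + 2 + i'` with `i ≤ g (t j)`, `i' ≤ g (t j')` forces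
`j = j'` and `i = i'`. [folklore] -/
theorem levels_injective {t g : ℕ → ℕ} (hgap : ∀ j, t j + g (t j) < t (j + 1)) {j j' i i' : ℕ}
    (hi : i ≤ g (t j)) (hi' : i' ≤ g (t j')) (h : 2 * t j + 2 + i = 2 * t j' + 2 + i') :
    j = j' ∧ i = i' := by
  have hmono := strictMono_of_gap hgap
  rcases lt_trichotomy j j' with hlt | rfl | hgt
  · exfalso
    have h1 : t (j + 1) ≤ t j' := hmono.monotone hlt
    have := hgap j
    omega
  · exact ⟨rfl, by omega⟩
  · exfalso
    have h1 : t (j' + 1) ≤ t j := hmono.monotone hgt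
    have := hgap j'
    omega

/-- A property holding at every term of a strictly increasing sequence holds frequently. [folklore] -/
theorem frequently_of_seq {t : ℕ → ℕ} (ht : StrictMono t) {Q : ℕ → Prop} (hQ : ∀ j, Q (t j)) :
    ∃ᶠ n in atTop, Q n :=
  Filter.frequently_atTop.2 fun a => ⟨t a, ht.id_le a, hQ a⟩

/-- A distribution supported inside a singleton is the point mass. [folklore] -/
theorem eq_pure_of_support_subset {α : Type*} {p : PMF α} {a : α} (h : p.support ⊆ {a}) : p = PMF.pure a := by
  have hsupp : p.support = {a} := by
    refine Set.Subset.antisymm h ?_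
    obtain ⟨b, hb⟩ := p.support_nonempty
    have hba : b = a := h hb
    rw [Set.singleton_subset_iff, ← hba]
    exact hb
  ext x
  by_cases hx : x = a
  · subst hx
    rw [PMF.pure_apply_self]
    exact (PMF.apply_eq_one_iff p x).2 hsupp
  · rw [PMF.pure_apply_of_ne _ _ hx]
    exact (PMF.apply_eq_zero_iff p x).2 fun hm => hx (h hm)

/-- At a level with `ℓ n = 0`, an ensemble on `ℓ n`-bit strings coincides with the uniform
ensemble (both are the point mass at the empty string), so every distinguisher has gap `0`. [folklore] -/
theorem distAdvantage_eq_zero_of_len_zero (D : RandAlg (List Bool) Bool) (X : Ensemble (List Bool)) (ℓ : ℕ → ℕ)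
    {n : ℕ} (hlen : ∀ x ∈ (X n).support, x.length = ℓ n) (h0 : ℓ n = 0) :
    distAdvantage D X (uniformEnsemble ℓ) n = 0 := by
  have hX : X n = PMF.pure [] := eq_pure_of_support_subset fun x hx =>
    List.eq_nil_of_length_eq_zero ((hlen x hx).trans h0)
  have hU : uniformEnsemble ℓ n = PMF.pure [] := by
    refine eq_pure_of_support_subset fun x hx => ?_
    rw [uniformEnsemble, h0, uniformBits, PMF.mem_support_map_iff] at hx
    obtain ⟨v, -, rfl⟩ := hx
    exact List.eq_nil_of_length_eq_zero v.toList_length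
  rw [distAdvantage, hX, hU, sub_self, abs_zero]

/-! ### Only-if direction: pseudorandom ensembles are unpredictable -/

/-- **Pseudorandomness implies next-bit unpredictability** (for ensembles on `ℓ n`-bit strings).
[Goldreich 2001, Thm. 3.3.7, "only-if" direction; Arora–Barak 2009, Thm. 9.11]
[cite: Goldreich2001, Thm. 3.3.7 (proof, only-if direction)] -/
theorem isNextBitUnpredictable_of_isPseudorandom (X : Ensemble (List Bool)) (ℓ : ℕ → ℕ)
    (hlen : ∀ n, ∀ x ∈ (X n).support, x.length = ℓ n) (hP : IsPseudorandom X ℓ) :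
    IsNextBitUnpredictable X ℓ := by
  classical
  intro A hA
  by_contra hnot
  obtain ⟨k, δ, hδ, hfreq⟩ := exists_frequently_of_not_superpolynomialDecay hnot
  obtain ⟨t, htP, htgap⟩ := exists_sparse_seq hfreq ℓ
  obtain ⟨qA, hqA⟩ := hA.2
  -- the bad levels have `ℓ (t j) ≥ 1`
  have hℓpos : ∀ j, 0 < ℓ (t j) := by
    intro j
    by_contra h0
    have h0' : ℓ (t j) = 0 := by omega
    have hz : nextBitAdvantage A X ℓ (t j) = 0 := by unfold nextBitAdvantage; rw [h0']
    have := htP j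
    rw [hz, abs_zero, mul_zero] at this
    linarith
  -- the most biased position at each bad level
  have hbest : ∀ j, ∃ i₀ < ℓ (t j), |nextBitAdvantage A X ℓ (t j)| ≤ |succProb A (t j) (X (t j)) i₀ - 1 / 2| :=
    fun j => exists_abs_nextBitAdvantage_le A X ℓ rfl (hℓpos j)
  choose i₀ hi₀ hbi₀ using hbest
  have hκB : ∀ j, A.coinLen (2 * t j + 2 + i₀ j) < qA.eval (2 * t j + 2 + ℓ (t j)) + 1 := fun j =>
    Nat.lt_succ_of_le ((hqA _).trans (TM2Iter.eval_mono qA (by have := hi₀ j; omega)))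
  -- the coin budget of `D_A`: at the input length of level `t j`, encode `(i₀ j, κ j)`
  obtain ⟨cl, hcl, hclpoly⟩ : ∃ cl : ℕ → ℕ,
      (∀ j, cl (2 * t j + 2 + ℓ (t j)) = A.coinLen (2 * t j + 2 + i₀ j) + (qA.eval (2 * t j + 2 + ℓ (t j)) + 1) * i₀ j) ∧
      ∃ P : Polynomial ℕ, ∀ L, cl L ≤ P.eval L := by
    refine ⟨fun L => if h : ∃ j, L = 2 * t j + 2 + ℓ (t j) then
        A.coinLen (2 * t (Classical.choose h) + 2 + i₀ (Classical.choose h)) +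
          (qA.eval (2 * t (Classical.choose h) + 2 + ℓ (t (Classical.choose h))) + 1) * i₀ (Classical.choose h)
      else 0, fun j => ?_, ⟨(qA + 1) * (Polynomial.X + 1), fun L => ?_⟩⟩
    · have h : ∃ j', 2 * t j + 2 + ℓ (t j) = 2 * t j' + 2 + ℓ (t j') := ⟨j, rfl⟩
      dsimp only
      rw [dif_pos h]
      have hj : Classical.choose h = j :=
        (levels_injective (g := ℓ) htgap le_rfl le_rfl (Classical.choose_spec h)).1.symm
      rw [hj]
    · dsimp only
      split_ifs with h
      · have hL := Classical.choose_spec h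
        set j := Classical.choose h
        rw [Polynomial.eval_mul, Polynomial.eval_add, Polynomial.eval_add, Polynomial.eval_X, Polynomial.eval_one]
        have hi := hi₀ j
        have hκ : A.coinLen (2 * t j + 2 + i₀ j) ≤ qA.eval L := (hqA _).trans (TM2Iter.eval_mono qA (by omega))
        have hB : qA.eval (2 * t j + 2 + ℓ (t j)) = qA.eval L := by rw [hL]
        have hprod : (qA.eval L + 1) * i₀ j ≤ (qA.eval L + 1) * L := Nat.mul_le_mul_left _ (by omega)
        rw [hB, mul_add_one]
        omega
      · exact Nat.zero_le _
  -- `D_A` is a PPT distinguisher with gap at least `|nextBitAdvantage A|` at every bad level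
  have hD : IsPPT (distAlg A qA cl) encodeBool := isPPT_distAlg hA qA hclpoly
  refine not_superpolynomialDecay_of_frequently (k := k) hδ ?_ (hP (distAlg A qA cl) hD)
  refine frequently_of_seq (strictMono_of_gap htgap)
    (Q := fun n => δ ≤ (n : ℝ) ^ k * |distAdvantage (distAlg A qA cl) X (uniformEnsemble ℓ) n|) fun j => ?_
  rw [distAdvantage_distAlg (A := A) (qA := qA) (cl := cl) X ℓ rfl (hlen (t j)) (hi₀ j) (hcl j) (hκB j), abs_abs]
  exact (htP j).trans (mul_le_mul_of_nonneg_left (hbi₀ j) (by positivity))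

/-! ### If direction: unpredictable ensembles are pseudorandom -/

/-- **Next-bit unpredictability implies pseudorandomness** (for ensembles on `ℓ n`-bit strings,
`ℓ` polynomially bounded and polynomial-time computable in unary).
[Goldreich 2001, Thm. 3.3.7, "opposite" direction (Claims 3.3.7.1–3.3.7.2); Arora–Barak 2009,
Thm. 9.11] [cite: Goldreich2001, Thm. 3.3.7 (proof, opposite direction)] -/
theorem isPseudorandom_of_isNextBitUnpredictable (X : Ensemble (List Bool)) (ℓ : ℕ → ℕ)
    (hℓ : ∃ p : Polynomial ℕ, ∀ n, ℓ n ≤ p.eval n) (hcomp : PolyTimeComputable unaryEncodeNat unaryEncodeNat ℓ)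
    (hlen : ∀ n, ∀ x ∈ (X n).support, x.length = ℓ n) (hU : IsNextBitUnpredictable X ℓ) :
    IsPseudorandom X ℓ := by
  classical
  intro D hD
  by_contra hnot
  obtain ⟨k, δ, hδ, hfreq⟩ := exists_frequently_of_not_superpolynomialDecay hnot
  obtain ⟨t, htP, htgap⟩ := exists_sparse_seq hfreq ℓ
  obtain ⟨qD, hqD⟩ := hD.2
  obtain ⟨p, hp⟩ := hℓ
  -- the bad levels have `ℓ (t j) ≥ 1`
  have hℓpos : ∀ j, 0 < ℓ (t j) := by
    intro j
    by_contra h0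
    have hz := distAdvantage_eq_zero_of_len_zero D X ℓ (hlen (t j)) (by omega)
    have := htP j
    rw [hz, abs_zero, mul_zero] at this
    linarith
  -- the coin budget of `A_D`: `ℓ(t j) − i` padding bits plus `D`'s coins at level `t j`
  obtain ⟨cl, hcl, hclpoly⟩ : ∃ cl : ℕ → ℕ,
      (∀ j, ∀ i < ℓ (t j), cl (2 * t j + 2 + i) = (ℓ (t j) - i) + D.coinLen (2 * t j + 2 + ℓ (t j))) ∧
      ∃ P : Polynomial ℕ, ∀ L, cl L ≤ P.eval L := by
    refine ⟨fun L => if h : ∃ ji : ℕ × ℕ, ji.2 ≤ ℓ (t ji.1) ∧ L = 2 * t ji.1 + 2 + ji.2 then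
        (ℓ (t (Classical.choose h).1) - (Classical.choose h).2) +
          D.coinLen (2 * t (Classical.choose h).1 + 2 + ℓ (t (Classical.choose h).1))
      else 0, fun j i hi => ?_, ⟨p + qD.comp (Polynomial.X + p), fun L => ?_⟩⟩
    · have h : ∃ ji : ℕ × ℕ, ji.2 ≤ ℓ (t ji.1) ∧ 2 * t j + 2 + i = 2 * t ji.1 + 2 + ji.2 := ⟨(j, i), hi.le, rfl⟩
      dsimp only
      rw [dif_pos h]
      obtain ⟨hle, heq⟩ := Classical.choose_spec h
      obtain ⟨hj, hi'⟩ := levels_injective (g := ℓ) htgap hi.le hle heq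
      rw [← hj, ← hi']
    · dsimp only
      split_ifs with h
      · obtain ⟨hle, hL⟩ := Classical.choose_spec h
        set j := (Classical.choose h).1
        set i := (Classical.choose h).2
        rw [Polynomial.eval_add, Polynomial.eval_comp, Polynomial.eval_add, Polynomial.eval_X]
        have h2 : ℓ (t j) ≤ p.eval L := (hp _).trans (TM2Iter.eval_mono p (by omega))
        have h3 : D.coinLen (2 * t j + 2 + ℓ (t j)) ≤ qD.eval (L + p.eval L) :=
          (hqD _).trans (TM2Iter.eval_mono qD (by omega))
        omega
      · exact Nat.zero_le _
  -- `A_D` is a PPT predictor with advantage `gap / ℓ` at every bad level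
  have hA : IsPPT (predAlg D ℓ cl) encodeBool := isPPT_predAlg hD hcomp hclpoly
  have hdec := (hU (predAlg D ℓ cl) hA).polynomial_mul (p.map (Nat.castRingHom ℝ))
  refine not_superpolynomialDecay_of_frequently (k := k) hδ ?_ hdec
  refine frequently_of_seq (strictMono_of_gap htgap)
    (Q := fun n => δ ≤ (n : ℝ) ^ k * |(p.map (Nat.castRingHom ℝ)).eval (n : ℝ) * nextBitAdvantage (predAlg D ℓ cl) X ℓ n|)
    fun j => ?_
  rw [Polynomial.eval_natCast_map, Nat.coe_castRingHom, Nat.cast_id,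
    nextBitAdvantage_predAlg (D := D) (ℓ := ℓ) (cl := cl) X rfl (hℓpos j) (hlen (t j)) (hcl j)]
  have hPt := htP j
  have hℓle : (ℓ (t j) : ℝ) ≤ (p.eval (t j) : ℕ) := by exact_mod_cast hp (t j)
  have hℓpos' : (0 : ℝ) < ℓ (t j) := by exact_mod_cast hℓpos j
  have hd : distAdvantage D X (uniformEnsemble ℓ) (t j) =
      |(acceptPMF D (t j) (X (t j)) true).toReal - (acceptPMF D (t j) (uniformBits (ℓ (t j))) true).toReal| := rfl
  rw [hd, abs_abs] at hPt
  rw [abs_mul, abs_div, Nat.abs_cast, Nat.abs_cast]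
  refine hPt.trans (mul_le_mul_of_nonneg_left ?_ (by positivity))
  rw [← mul_div_assoc, le_div_iff₀ hℓpos']
  exact (mul_le_mul_of_nonneg_left hℓle (abs_nonneg _)).trans_eq (mul_comm _ _)

end YaoNB

/-- **crypto-foundations.S21, discharged** (Yao's theorem): for an ensemble `X` on `ℓ n`-bit
strings with `ℓ` polynomially bounded and polynomial-time computable in unary, `X` is
pseudorandom iff it is next-bit unpredictable (random-position form). Both directions by
contradiction along a sparse subsequence of the bad levels, with the reductions
`YaoNB.distAlg` (predictor ↦ distinguisher testing the most biased position) and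
`YaoNB.predAlg` (distinguisher ↦ predictor padding with fresh coins; hybrid/telescoping
identity). [Yao 1982; Goldreich 2001, Thm. 3.3.7 (proof, pp. 119–123 of the 2004 printing);
Arora–Barak 2009, Thm. 9.11] [cite: Yao1982] [cite: Goldreich2001, Thm. 3.3.7] -/
theorem isPseudorandom_iff_isNextBitUnpredictable_holds : isPseudorandom_iff_isNextBitUnpredictable := by
  intro X ℓ hℓ hcomp hlen
  exact ⟨YaoNB.isNextBitUnpredictable_of_isPseudorandom X ℓ hlen,
    YaoNB.isPseudorandom_of_isNextBitUnpredictable X ℓ hℓ hcomp hlen⟩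

end Literature.Computability.Cryptography
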